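import Mathlib.Algebra.Lie.Free
import Literature.Algebra.Lie.SurfaceLieAlgebra
import Literature.Algebra.Lie.FreeLieAlgebraGrading
import HarnessLib

/-!
# Helper `Comb` for stub `stub_dTwoSpan` of line `saturated-torsor-descent`, crux
`CongruenceShadows.NilpotentShadowsStandard` (item stmt-SmoothPoincare4-14594)

**The bracelet lemma.** For a degree-`3` tuple `v : Fin n → L₃(ℤⁿ)` put
`H(j,p,q,r) := ` coefficient of the word `pqr` in `φ(v j) ∈ ℤ⟨X⟩` (`φ = toTensor`). Then
* the kernel condition `∑ⱼ ⁅xⱼ, vⱼ⁆ = 0` says `H(j,p,q,r) = H(r,j,p,q)` (rotation, `C1`);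
* `vⱼ ∈ L₃` says `H(j,p,q,r) = H(j,r,q,p)` (reversal, `C2`: Lie elements of odd degree are
  palindromic) and `∑_{σ ∈ S₃} H(j,σ(p,q,r)) = 0` (`C3`: Lie elements of degree `≥ 2` die in the
  commutative quotient).
So `H` is a function on bracelets of four letters with vanishing content sums. This file proves the
purely combinatorial statement `DTwoSpan.bracelet_eq_zero`: such an `H` vanishes identically as soon
as it vanishes on the four families of *pivot* words
`(y;x,x,y)` (`x<y`), `(y;x,x,z)` (`y<z`, `x∉{y,z}`), `(w;z,y,x)` and `(w;y,z,x)` (`x<y<z<w`) — the words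
at which the sibling stub `stub_dTwoIndep` reads off the coefficients `α, β, γ, δ` of the square/tree
tuples. Case analysis on the pattern of coincidences among `j,p,q,r`; `omega` on `Fin n`.
Mathlib only; no definitions, no named facts.
-/

-- the prescribed namespace `Summit.<P>.<Sub>.…` duplicates `SmoothPoincare4` (P = Sub)
set_option linter.dupNamespace false

namespace Summit.SmoothPoincare4.SmoothPoincare4.Theorems.NilpotentShadowsStandard.SaturatedTorsorDescent

namespace DTwoSpan

variable {n : ℕ}

/-- **Bracelet lemma, repeated letters.** A rotation- and reversal-invariant `H` with vanishing
content sums which vanishes at the pivots `(y;x,x,y)` (`x<y`) and `(y;x,x,z)` (`y<z`, `x∉{y,z}`)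
vanishes at every word with a repeated letter. [folklore] -/
theorem bracelet_eq_zero_of_rep (H : Fin n → Fin n → Fin n → Fin n → ℤ)
    (hC1 : ∀ j p q r, H j p q r = H r j p q) (hC2 : ∀ j p q r, H j p q r = H j r q p)
    (hC3 : ∀ j p q r, H j p q r + H j p r q + H j q p r + H j q r p + H j r p q + H j r q p = 0)
    (hP1 : ∀ x y, x < y → H y x x y = 0)
    (hP2 : ∀ x y z, y < z → x ≠ y → x ≠ z → H y x x z = 0) :
    (∀ x y z, H x x y z = 0) ∧ (∀ x y z, H x y x z = 0) ∧ (∀ x y z, H x y z x = 0) ∧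
      (∀ x y z, H y x x z = 0) ∧ (∀ x y z, H y x z x = 0) ∧ (∀ x y z, H y z x x = 0) := by
  -- three equal letters: `6 H = 0`
  have h3 : ∀ a b, H b a a a = 0 := fun a b => by have := hC3 b a a a; omega
  -- an adjacent repeated pair
  have hadj : ∀ x y z, H y x x z = 0 := by
    intro x y z
    by_cases hxy : x = y
    · subst hxy; rw [hC1]; exact h3 x z
    by_cases hxz : x = z
    · subst hxz; exact h3 x y
    by_cases hyz : y = z
    · subst hyz
      rcases lt_or_gt_of_ne hxy with h | h
      · exact hP1 x y h
      · rw [hC1, hC1]; exact hP1 y x h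
    rcases lt_or_gt_of_ne hyz with h | h
    · exact hP2 x y z h hxy hxz
    · rw [hC2, hC1, hC1, hC1]; exact hP2 x z y h hxz hxy
  have hadj12 : ∀ x y z, H x x y z = 0 := fun x y z => by rw [hC1]; exact hadj x z y
  have hadj41 : ∀ x y z, H x y z x = 0 := fun x y z => by rw [hC1]; exact hadj12 x y z
  have hadj34 : ∀ x y z, H y z x x = 0 := fun x y z => by rw [hC1]; exact hadj41 x y z
  -- an opposite repeated pair: content sum at `(y; x,x,z)`
  have hopp24 : ∀ x y z, H y x z x = 0 := fun x y z => by
    have e := hC3 y x x z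
    have h1 := hadj x y z
    have h2 := hadj34 x y z
    omega
  have hopp13 : ∀ x y z, H x y x z = 0 := fun x y z => by rw [hC1]; exact hopp24 x z y
  exact ⟨hadj12, hopp13, hadj41, hadj, hopp24, hadj34⟩

/-- **Bracelet lemma, distinct letters.** Under rotation/reversal invariance and vanishing content
sums, vanishing at the pivots `(w;z,y,x)`, `(w;y,z,x)` (`x<y<z<w`) forces vanishing at every word with
four distinct letters. [folklore] -/
theorem bracelet_eq_zero_of_distinct (H : Fin n → Fin n → Fin n → Fin n → ℤ)
    (hC1 : ∀ j p q r, H j p q r = H r j p q) (hC2 : ∀ j p q r, H j p q r = H j r q p)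
    (hC3 : ∀ j p q r, H j p q r + H j p r q + H j q p r + H j q r p + H j r p q + H j r q p = 0)
    (hP3 : ∀ x y z w, x < y → y < z → z < w → H w z y x = 0)
    (hP4 : ∀ x y z w, x < y → y < z → z < w → H w y z x = 0) :
    ∀ j p q r, j ≠ p → j ≠ q → j ≠ r → p ≠ q → p ≠ r → q ≠ r → H j p q r = 0 := by
  -- minimum in front, the rest sorted as `y < z < w`: all six arrangements vanish
  have key : ∀ x y z w, x < y → y < z → z < w →
      H x y z w = 0 ∧ H x y w z = 0 ∧ H x z y w = 0 ∧ H x z w y = 0 ∧ H x w y z = 0 ∧ H x w z y = 0 := by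
    intro x y z w hxy hyz hzw
    have hA : H x y z w = 0 := by
      have := hP3 x y z w hxy hyz hzw
      rwa [hC2, hC1, hC1, hC1] at this
    have hB : H x z y w = 0 := by
      have := hP4 x y z w hxy hyz hzw
      rwa [hC2, hC1, hC1, hC1] at this
    have h1 : H x z w y = H x y w z := hC2 _ _ _ _
    have h2 : H x w y z = H x z y w := hC2 _ _ _ _
    have h3 : H x w z y = H x y z w := hC2 _ _ _ _
    have := hC3 x y z w
    refine ⟨hA, ?_, hB, ?_, ?_, ?_⟩ <;> omega
  -- minimum in front, the rest in any order
  have hmin : ∀ x p q r, x < p → x < q → x < r → p ≠ q → p ≠ r → q ≠ r → H x p q r = 0 := by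
    intro x p q r hp hq hr hpq hpr hqr
    rcases lt_or_gt_of_ne hpq with h₁ | h₁
    · rcases lt_or_gt_of_ne hqr with h₂ | h₂
      · exact (key x p q r hp h₁ h₂).1
      · rcases lt_or_gt_of_ne hpr with h₃ | h₃
        · exact (key x p r q hp h₃ h₂).2.1
        · exact (key x r p q hr h₃ h₁).2.2.2.1
    · rcases lt_or_gt_of_ne hpr with h₃ | h₃
      · exact (key x q p r hq h₁ h₃).2.2.1
      · rcases lt_or_gt_of_ne hqr with h₂ | h₂
        · exact (key x q r p hq h₂ h₃).2.2.2.2.1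
        · exact (key x r q p hr h₂ h₁).2.2.2.2.2
  -- rotate the minimum to the front
  intro j p q r h1 h2 h3 h4 h5 h6
  obtain hj | hp | hq | hr : (j < p ∧ j < q ∧ j < r) ∨ (p < j ∧ p < q ∧ p < r) ∨
      (q < j ∧ q < p ∧ q < r) ∨ (r < j ∧ r < p ∧ r < q) := by omega
  · exact hmin j p q r hj.1 hj.2.1 hj.2.2 h4 h5 h6
  · rw [hC1, hC1, hC1]; exact hmin p q r j hp.2.1 hp.2.2 hp.1 h6 (Ne.symm h2) (Ne.symm h3)
  · rw [hC1, hC1]; exact hmin q r j p hq.2.2 hq.1 hq.2.1 (Ne.symm h3) (Ne.symm h5) h1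
  · rw [hC1]; exact hmin r j p q hr.1 hr.2.1 hr.2.2 h1 h2 h4

/-- **Bracelet lemma.** A function `H` of four letters which is invariant under the rotation
`(j,p,q,r) ↦ (r,j,p,q)` and the reversal `(j,p,q,r) ↦ (j,r,q,p)`, whose content sums
`∑_{σ ∈ S₃} H(j, σ(p,q,r))` vanish, and which vanishes at the pivot words `(y;x,x,y)` (`x<y`),
`(y;x,x,z)` (`y<z`, `x∉{y,z}`), `(w;z,y,x)`, `(w;y,z,x)` (`x<y<z<w`), vanishes identically. (This is
`rank D₂(ℤⁿ) ≤ n²(n²-1)/12`, bracelet by bracelet.) [folklore] -/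
theorem bracelet_eq_zero (H : Fin n → Fin n → Fin n → Fin n → ℤ)
    (hC1 : ∀ j p q r, H j p q r = H r j p q) (hC2 : ∀ j p q r, H j p q r = H j r q p)
    (hC3 : ∀ j p q r, H j p q r + H j p r q + H j q p r + H j q r p + H j r p q + H j r q p = 0)
    (hP1 : ∀ x y, x < y → H y x x y = 0)
    (hP2 : ∀ x y z, y < z → x ≠ y → x ≠ z → H y x x z = 0)
    (hP3 : ∀ x y z w, x < y → y < z → z < w → H w z y x = 0)
    (hP4 : ∀ x y z w, x < y → y < z → z < w → H w y z x = 0) :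
    ∀ j p q r, H j p q r = 0 := by
  obtain ⟨e12, e13, e41, e23, e24, e34⟩ := bracelet_eq_zero_of_rep H hC1 hC2 hC3 hP1 hP2
  have hdist := bracelet_eq_zero_of_distinct H hC1 hC2 hC3 hP3 hP4
  intro j p q r
  by_cases h1 : j = p
  · subst h1; exact e12 j q r
  by_cases h2 : j = q
  · subst h2; exact e13 j p r
  by_cases h3 : j = r
  · subst h3; exact e41 j p q
  by_cases h4 : p = q
  · subst h4; exact e23 p j r
  by_cases h5 : p = r
  · subst h5; exact e24 p j q
  by_cases h6 : q = r
  · subst h6; exact e34 q j p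
  exact hdist j p q r h1 h2 h3 h4 h5 h6

end DTwoSpan

/-- Helper `helper_dTwoSpanBracelet` (registered sub-goal of stub `stub_dTwoSpan`) · **the bracelet
lemma**: a function of four letters of `Fin n` with values in `ℤ` which is invariant under the
rotation `(j,p,q,r) ↦ (r,j,p,q)` and the reversal `(j,p,q,r) ↦ (j,r,q,p)`, has vanishing content sums
`∑_{σ ∈ S₃} H(j,σ(p,q,r))`, and vanishes at the pivot words `(y;x,x,y)` (`x<y`), `(y;x,x,z)`
(`y<z`, `x∉{y,z}`), `(w;z,y,x)`, `(w;y,z,x)` (`x<y<z<w`), vanishes identically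
(`DTwoSpan.bracelet_eq_zero`). [folklore] -/
theorem helper_dTwoSpanBracelet : ∀ (n : ℕ) (H : Fin n → Fin n → Fin n → Fin n → ℤ), (∀ j p q r, H j p q r = H r j p q) → (∀ j p q r, H j p q r = H j r q p) → (∀ j p q r, H j p q r + H j p r q + H j q p r + H j q r p + H j r p q + H j r q p = 0) → (∀ x y, x < y → H y x x y = 0) → (∀ x y z, y < z → x ≠ y → x ≠ z → H y x x z = 0) → (∀ x y z w, x < y → y < z → z < w → H w z y x = 0) → (∀ x y z w, x < y → y < z → z < w → H w y z x = 0) → ∀ j p q r, H j p q r = 0 :=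
  fun _ H => DTwoSpan.bracelet_eq_zero H

end Summit.SmoothPoincare4.SmoothPoincare4.Theorems.NilpotentShadowsStandard.SaturatedTorsorDescent
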